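import Summits.CriticalPhenomena.Ising3DConformalLimit.Theorems.AnomalousForcesInteractionEtaPositiveSusceptibilityForm
import HarnessLib

/-!
# The bubble form of the crux `EtaPositive` (stmt-CriticalPhenomena-2600)

Support file for crux `EtaPositive` of route `AnomalousForcesInteraction` (sub-problem `Ising3DConformalLimit`).
Write `G(x) = ⟨σ₀σ_x⟩⁺_{β_c(3),0}` (`criticalTwoPoint 3`, sup norm on `ℤ³`) and `B_L = Σ_{y ∈ Λ_L} G(y)²` for the
bubble diagram truncated at scale `L` (`Λ_L = box 3 L`). The infrared bound gives `B_L ≲ L`; this file proves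
that the crux `EtaPositive := ∃ κ > 0, C, ∀ x ≠ 0, G(x) ≤ C ‖x‖^{-(1+κ)}` ("`η(3) > 0` in power form") is
EQUIVALENT to a power gain on the bubble:

  `EtaPositive ⟺ ∃ κ > 0, C, ∀ L ≥ 1, B_L ≤ C L^{1-κ}`   (`EtaPositive_iff_bubble_gain`),

with the two quantitative directions `bubble_le_of_criticalTwoPoint_decay` (shell counting, using the
elementary `Σ_{k<L} (k+1)^{-s} ≤ L^{1-s}/(1-s)`, `sum_range_succ_rpow_neg_le`) and
`criticalTwoPoint_decay_of_bubble_le` (Messager–Miracle-Solé: `(2L+1)³ G(x)² ≤ B_L` for `3L ≤ ‖x‖_∞`,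
as in `card_box_mul_criticalTwoPoint_sq_le_bubble` of `…GainIOEntrances`, p172298).
The bubble diagram is the quantity that drives the random-current multiscale analysis (Aizenman 1982;
Aizenman–Duminil-Copin 2021 §6; Duminil-Copin–Panis 2025), so this is the currency in which that technology
would have to deliver the crux; the i.o. version feeding the split child `EtaGainIO` is
`etaGainIO_of_bubble_gain_io` (file `…GainIOEntrances`). Standard axioms, no named fact.
-/

noncomputable section

namespace Summit.CriticalPhenomena.Ising3DConformalLimit.AnomalousForcesInteractionEtaPositive

open Finset Literature.Probability.LatticeModels

/-- Elementary: `Σ_{k<L} (k+1)^{-s} ≤ L^{1-s}/(1-s)` for `0 ≤ s < 1` (Bernoulli's inequality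
`(1 - 1/(n+1))^{1-s} ≤ 1 - (1-s)/(n+1)`, i.e. `n^{1-s} ≤ (n+1)^{1-s} - (1-s)(n+1)^{-s}`, telescoped). -/
theorem sum_range_succ_rpow_neg_le {s : ℝ} (hs0 : 0 ≤ s) (hs1 : s < 1) (L : ℕ) :
    ∑ k ∈ Finset.range L, ((k : ℝ) + 1) ^ (-s) ≤ (L : ℝ) ^ (1 - s) / (1 - s) := by
  have h1s : 0 < 1 - s := by linarith
  induction L with
  | zero => simp [Real.zero_rpow h1s.ne']
  | succ n ih =>
    rw [Finset.sum_range_succ]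
    push_cast
    -- Bernoulli at `t = n+1`: `n^{1-s} ≤ t^{1-s} - (1-s) t^{-s}`
    set t : ℝ := (n : ℝ) + 1 with htdef
    have ht : 0 < t := by positivity
    have htne : t ≠ 0 := ht.ne'
    have ht1 : 1 ≤ t := by rw [htdef]; linarith [(Nat.cast_nonneg n : (0 : ℝ) ≤ n)]
    have hB : (n : ℝ) ^ (1 - s) ≤ t ^ (1 - s) - (1 - s) * t ^ (-s) := by
      have hu : -1 ≤ -(1 / t) := by
        rw [neg_le_neg_iff]; exact (div_le_one ht).2 ht1
      have key := rpow_one_add_le_one_add_mul_self hu (p := 1 - s) h1s.le (by linarith)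
      have h0 : 0 ≤ 1 + -(1 / t) := by linarith
      have hn : (n : ℝ) = t * (1 + -(1 / t)) := by rw [htdef]; field_simp; ring
      have htp : 0 < t ^ (1 - s) := Real.rpow_pos_of_pos ht _
      have hsplit : t ^ (1 - s) * (1 + (1 - s) * -(1 / t)) = t ^ (1 - s) - (1 - s) * t ^ (-s) := by
        have h3 : t ^ (1 - s) = t * t ^ (-s) := by
          rw [show (1 : ℝ) - s = 1 + -s by ring, Real.rpow_add ht, Real.rpow_one]
        rw [h3]; field_simp; ring
      calc (n : ℝ) ^ (1 - s) = (t * (1 + -(1 / t))) ^ (1 - s) := by rw [← hn]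
        _ = t ^ (1 - s) * (1 + -(1 / t)) ^ (1 - s) := Real.mul_rpow ht.le h0
        _ ≤ t ^ (1 - s) * (1 + (1 - s) * -(1 / t)) := mul_le_mul_of_nonneg_left key htp.le
        _ = t ^ (1 - s) - (1 - s) * t ^ (-s) := hsplit
    calc ∑ k ∈ Finset.range n, ((k : ℝ) + 1) ^ (-s) + t ^ (-s)
        ≤ (n : ℝ) ^ (1 - s) / (1 - s) + t ^ (-s) := by linarith [ih]
      _ ≤ (t ^ (1 - s) - (1 - s) * t ^ (-s)) / (1 - s) + t ^ (-s) := by gcongr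
      _ = t ^ (1 - s) / (1 - s) := by field_simp; ring

/-- **Shell sum for the bubble, quantitative.** If `G(x) ≤ C ‖x‖^{-(1+κ)}` for all `x ≠ 0`, with
`0 < κ ≤ 1/4`, then `B_L = Σ_{y ∈ Λ_L} G(y)² ≤ 1 + 108 C² L^{1-2κ}` for every `L`
(`|∂Λ_{k+1}| ≤ 54 (k+1)²`, `G² ≤ C² (k+1)^{-(2+2κ)}` on it, `Σ_{k<L} (k+1)^{-2κ} ≤ 2 L^{1-2κ}`, `G(0)² ≤ 1`). -/
theorem bubble_le_of_criticalTwoPoint_decay {κ C : ℝ} (hκ0 : 0 < κ) (hκ1 : κ ≤ 1 / 4)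
    (h : ∀ x : Site 3, x ≠ 0 → criticalTwoPoint 3 x ≤ C * (‖x‖ : ℝ) ^ (-(1 + κ))) (L : ℕ) :
    ∑ y ∈ box 3 L, criticalTwoPoint 3 y ^ 2 ≤ 1 + 108 * C ^ 2 * (L : ℝ) ^ (1 - 2 * κ) := by
  -- one shell
  have hshell : ∀ k : ℕ, ∑ v ∈ sphere 3 (k + 1), criticalTwoPoint 3 v ^ 2 ≤
      54 * C ^ 2 * ((k : ℝ) + 1) ^ (-(2 * κ)) := by
    intro k
    have hk1 : (0 : ℝ) < (k : ℝ) + 1 := by positivity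
    have hpt : ∀ v ∈ sphere 3 (k + 1),
        criticalTwoPoint 3 v ^ 2 ≤ C ^ 2 * ((k : ℝ) + 1) ^ (-(2 + 2 * κ)) := by
      intro v hv
      have hvn : Site.supNorm v = k + 1 := mem_sphere.1 hv
      have hv0 : v ≠ 0 := fun h0 => by rw [h0, Site.supNorm_eq_zero_iff.2 rfl] at hvn; omega
      have hnorm : (‖v‖ : ℝ) = (k : ℝ) + 1 := by
        rw [Site.norm_eq_supNorm, hvn]; push_cast; ring
      have hG := h v hv0
      rw [hnorm] at hG
      have hG0 : 0 ≤ criticalTwoPoint 3 v := twoPointPlus_nonneg_of_gks (criticalBeta_nonneg 3) v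
      have hsq : ((k : ℝ) + 1) ^ (-(2 + 2 * κ)) = (((k : ℝ) + 1) ^ (-(1 + κ))) ^ 2 := by
        rw [← Real.rpow_natCast, ← Real.rpow_mul hk1.le]; congr 1; push_cast; ring
      calc criticalTwoPoint 3 v ^ 2 ≤ (C * ((k : ℝ) + 1) ^ (-(1 + κ))) ^ 2 := pow_le_pow_left₀ hG0 hG 2
        _ = C ^ 2 * ((k : ℝ) + 1) ^ (-(2 + 2 * κ)) := by rw [mul_pow, hsq]
    have hexp : ((k : ℝ) + 1) ^ 2 * ((k : ℝ) + 1) ^ (-(2 + 2 * κ)) = ((k : ℝ) + 1) ^ (-(2 * κ)) := by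
      have h2 : ((k : ℝ) + 1) ^ 2 = ((k : ℝ) + 1) ^ (2 : ℝ) := by
        rw [← Real.rpow_natCast]; norm_num
      rw [h2, ← Real.rpow_add hk1]
      congr 1; ring
    calc ∑ v ∈ sphere 3 (k + 1), criticalTwoPoint 3 v ^ 2
        ≤ ∑ _v ∈ sphere 3 (k + 1), C ^ 2 * ((k : ℝ) + 1) ^ (-(2 + 2 * κ)) := Finset.sum_le_sum hpt
      _ = (#(sphere 3 (k + 1)) : ℝ) * (C ^ 2 * ((k : ℝ) + 1) ^ (-(2 + 2 * κ))) := by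
          rw [Finset.sum_const, nsmul_eq_mul]
      _ ≤ (2 * (3 : ℕ) * (2 * k + 3 : ℝ) ^ (3 - 1)) * (C ^ 2 * ((k : ℝ) + 1) ^ (-(2 + 2 * κ))) := by
          gcongr
          exact card_sphere_succ_le k
      _ ≤ (6 * (3 * ((k : ℝ) + 1)) ^ 2) * (C ^ 2 * ((k : ℝ) + 1) ^ (-(2 + 2 * κ))) := by
          gcongr
          · norm_num
          · linarith
      _ = 54 * C ^ 2 * (((k : ℝ) + 1) ^ 2 * ((k : ℝ) + 1) ^ (-(2 + 2 * κ))) := by ring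
      _ = 54 * C ^ 2 * ((k : ℝ) + 1) ^ (-(2 * κ)) := by rw [hexp]
  have hzero : ∑ v ∈ sphere 3 0, criticalTwoPoint 3 v ^ 2 ≤ 1 := by
    rw [sphere_zero, Finset.sum_singleton]
    have h1 : criticalTwoPoint 3 (0 : Site 3) ≤ 1 :=
      twoPointPlus_le_one_of_nonneg (criticalBeta_nonneg 3) (0 : Site 3)
    have h0 : 0 ≤ criticalTwoPoint 3 (0 : Site 3) :=
      twoPointPlus_nonneg_of_gks (criticalBeta_nonneg 3) (0 : Site 3)
    nlinarith
  -- the sum over shells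
  have hsum : ∑ k ∈ Finset.range L, ((k : ℝ) + 1) ^ (-(2 * κ)) ≤ 2 * (L : ℝ) ^ (1 - 2 * κ) := by
    have h1 := sum_range_succ_rpow_neg_le (s := 2 * κ) (by linarith) (by linarith) L
    have hp0 : 0 ≤ (L : ℝ) ^ (1 - 2 * κ) := Real.rpow_nonneg (Nat.cast_nonneg L) _
    have h2 : (L : ℝ) ^ (1 - 2 * κ) / (1 - 2 * κ) ≤ 2 * (L : ℝ) ^ (1 - 2 * κ) := by
      rw [div_le_iff₀ (by linarith)]; nlinarith
    exact h1.trans h2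
  have hC2 : 0 ≤ 54 * C ^ 2 := by positivity
  rw [sum_box_eq_sum_sphere, Finset.sum_range_succ']
  calc ∑ k ∈ Finset.range L, ∑ v ∈ sphere 3 (k + 1), criticalTwoPoint 3 v ^ 2
          + ∑ v ∈ sphere 3 0, criticalTwoPoint 3 v ^ 2
      ≤ ∑ k ∈ Finset.range L, 54 * C ^ 2 * ((k : ℝ) + 1) ^ (-(2 * κ)) + 1 := by
        gcongr with k hk
        exact hshell k
    _ = 54 * C ^ 2 * ∑ k ∈ Finset.range L, ((k : ℝ) + 1) ^ (-(2 * κ)) + 1 := by rw [Finset.mul_sum]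
    _ ≤ 54 * C ^ 2 * (2 * (L : ℝ) ^ (1 - 2 * κ)) + 1 := by gcongr
    _ = 1 + 108 * C ^ 2 * (L : ℝ) ^ (1 - 2 * κ) := by ring

/-- **MMS transport for the bubble, quantitative.** If `B_L = Σ_{y ∈ Λ_L} G(y)² ≤ C L^{1-κ}` for all `L ≥ 1`,
with `0 < κ ≤ 1` and `C ≥ 0`, then `G(x) ≤ (√(27C) + 4) ‖x‖^{-(1+κ/2)}` for every `x ≠ 0`: for
`n = ‖x‖_∞ ≥ 3` and `L = ⌊n/3⌋`, `(2L+1)³ G(x)² ≤ B_L ≤ C n^{1-κ}` with `(2L+1)³ ≥ n³/27`; for `n ≤ 2`,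
`G ≤ 1 ≤ 4 n^{-(1+κ/2)}`. -/
theorem criticalTwoPoint_decay_of_bubble_le {κ C : ℝ} (hκ0 : 0 < κ) (hκ1 : κ ≤ 1) (hC : 0 ≤ C)
    (h : ∀ L : ℕ, 1 ≤ L → ∑ y ∈ box 3 L, criticalTwoPoint 3 y ^ 2 ≤ C * (L : ℝ) ^ (1 - κ)) :
    ∀ x : Site 3, x ≠ 0 →
      criticalTwoPoint 3 x ≤ (Real.sqrt (27 * C) + 4) * (‖x‖ : ℝ) ^ (-(1 + κ / 2)) := by
  intro x hx
  obtain ⟨hnorm, hn1⟩ := norm_eq_supNorm_and_one_le hx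
  set n : ℕ := Site.supNorm x with hndef
  have hn0 : (0 : ℝ) < n := by linarith
  have hG1 : criticalTwoPoint 3 x ≤ 1 := twoPointPlus_le_one_of_nonneg (criticalBeta_nonneg 3) x
  have hG0 : 0 ≤ criticalTwoPoint 3 x := twoPointPlus_nonneg_of_gks (criticalBeta_nonneg 3) x
  have ht0 : 0 < (n : ℝ) ^ (-(1 + κ / 2)) := Real.rpow_pos_of_pos hn0 _
  have hs0 : 0 ≤ Real.sqrt (27 * C) := Real.sqrt_nonneg _
  rw [hnorm]
  by_cases h3 : 3 ≤ n
  · -- MAIN CASE `n ≥ 3`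
    set L : ℕ := n / 3 with hLdef
    have hL1 : 1 ≤ L := by omega
    have h3L : 3 * L ≤ Site.supNorm x := by rw [← hndef]; omega
    -- MMS, squared: `(2L+1)³ G(x)² ≤ B_L` (pointwise `0 ≤ G(x) ≤ G(y)` for `y ∈ Λ_L`, `3L ≤ ‖x‖_∞`;
    -- this is `card_box_mul_criticalTwoPoint_sq_le_bubble` of `…GainIOEntrances`, repeated inline)
    have hMMS : (2 * (L : ℝ) + 1) ^ 3 * criticalTwoPoint 3 x ^ 2 ≤ ∑ y ∈ box 3 L, criticalTwoPoint 3 y ^ 2 := by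
      have hcard : (#(box 3 L) : ℝ) = (2 * (L : ℝ) + 1) ^ 3 := by
        rw [card_box]; push_cast; ring
      calc (2 * (L : ℝ) + 1) ^ 3 * criticalTwoPoint 3 x ^ 2
          = ∑ _y ∈ box 3 L, criticalTwoPoint 3 x ^ 2 := by
            rw [Finset.sum_const, nsmul_eq_mul, hcard]
        _ ≤ ∑ y ∈ box 3 L, criticalTwoPoint 3 y ^ 2 := Finset.sum_le_sum fun y hy => by
            have hyx : 3 * Site.supNorm y ≤ Site.supNorm x :=
              (Nat.mul_le_mul_left 3 (mem_box_iff_supNorm_le.1 hy)).trans h3L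
            exact pow_le_pow_left₀ hG0
              (twoPointPlus_le_of_mul_supNorm_le (d := 3) (criticalBeta_nonneg 3) hyx) 2
    have hbub : ∑ y ∈ box 3 L, criticalTwoPoint 3 y ^ 2 ≤ C * (L : ℝ) ^ (1 - κ) := h L hL1
    have hLn : (L : ℝ) ≤ n := by exact_mod_cast Nat.div_le_self n 3
    have h2L1 : (n : ℝ) / 3 ≤ 2 * (L : ℝ) + 1 := by
      have : n ≤ 6 * L + 3 := by omega
      have : (n : ℝ) ≤ 6 * (L : ℝ) + 3 := by exact_mod_cast this
      linarith
    set P : ℝ := (2 * (L : ℝ) + 1) ^ 3 with hPdef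
    have hP0 : 0 < P := by positivity
    have hPn : (n : ℝ) ^ 3 / 27 ≤ P := by
      have h1 : ((n : ℝ) / 3) ^ 3 ≤ (2 * (L : ℝ) + 1) ^ 3 := pow_le_pow_left₀ (by positivity) h2L1 3
      have h2 : ((n : ℝ) / 3) ^ 3 = (n : ℝ) ^ 3 / 27 := by ring
      rw [hPdef, ← h2]; exact h1
    have hLpow : (L : ℝ) ^ (1 - κ) ≤ (n : ℝ) ^ (1 - κ) :=
      Real.rpow_le_rpow (Nat.cast_nonneg L) hLn (by linarith)
    have hPG : P * criticalTwoPoint 3 x ^ 2 ≤ C * (n : ℝ) ^ (1 - κ) :=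
      hMMS.trans (hbub.trans (mul_le_mul_of_nonneg_left hLpow hC))
    have hG2 : criticalTwoPoint 3 x ^ 2 ≤ C * (n : ℝ) ^ (1 - κ) * (27 / (n : ℝ) ^ 3) := by
      have h1 : criticalTwoPoint 3 x ^ 2 ≤ C * (n : ℝ) ^ (1 - κ) / P := by
        rw [le_div_iff₀ hP0]; linarith
      have h2 : C * (n : ℝ) ^ (1 - κ) / P ≤ C * (n : ℝ) ^ (1 - κ) * (27 / (n : ℝ) ^ 3) := by
        rw [div_eq_mul_inv]
        refine mul_le_mul_of_nonneg_left ?_ (by positivity)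
        have := inv_anti₀ (by positivity : (0 : ℝ) < (n : ℝ) ^ 3 / 27) hPn
        rwa [inv_div] at this
      exact h1.trans h2
    -- exponent bookkeeping `n^{1-κ} · n^{-3} = (n^{-(1+κ/2)})²`
    have hpow : (n : ℝ) ^ (1 - κ) * (27 / (n : ℝ) ^ 3) = 27 * ((n : ℝ) ^ (-(1 + κ / 2))) ^ 2 := by
      have hn3 : (n : ℝ) ^ 3 = (n : ℝ) ^ (3 : ℝ) := by rw [← Real.rpow_natCast]; norm_num
      have hA : (n : ℝ) ^ (1 - κ) * (27 / (n : ℝ) ^ 3) = 27 * ((n : ℝ) ^ (1 - κ) * ((n : ℝ) ^ 3)⁻¹) := by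
        ring
      have hB : ((n : ℝ) ^ 3)⁻¹ = (n : ℝ) ^ (-(3 : ℝ)) := by rw [Real.rpow_neg hn0.le, hn3]
      have hsq : ((n : ℝ) ^ (-(1 + κ / 2))) ^ 2 = (n : ℝ) ^ ((1 - κ) + -(3 : ℝ)) := by
        rw [← Real.rpow_natCast, ← Real.rpow_mul hn0.le]; congr 1; push_cast; ring
      rw [hA, hB, ← Real.rpow_add hn0, hsq]
    have hsq : criticalTwoPoint 3 x ^ 2 ≤ (Real.sqrt (27 * C) * (n : ℝ) ^ (-(1 + κ / 2))) ^ 2 := by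
      rw [mul_pow, Real.sq_sqrt (by positivity)]
      calc criticalTwoPoint 3 x ^ 2 ≤ C * (n : ℝ) ^ (1 - κ) * (27 / (n : ℝ) ^ 3) := hG2
        _ = C * ((n : ℝ) ^ (1 - κ) * (27 / (n : ℝ) ^ 3)) := by ring
        _ = 27 * C * ((n : ℝ) ^ (-(1 + κ / 2))) ^ 2 := by rw [hpow]; ring
    have hG : criticalTwoPoint 3 x ≤ Real.sqrt (27 * C) * (n : ℝ) ^ (-(1 + κ / 2)) :=
      (pow_le_pow_iff_left₀ hG0 (mul_nonneg hs0 ht0.le) two_ne_zero).1 hsq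
    calc criticalTwoPoint 3 x ≤ Real.sqrt (27 * C) * (n : ℝ) ^ (-(1 + κ / 2)) := hG
      _ ≤ (Real.sqrt (27 * C) + 4) * (n : ℝ) ^ (-(1 + κ / 2)) := by nlinarith [ht0]
  · -- SMALL CASE `n ≤ 2`: `G ≤ 1 ≤ 4 n^{-(1+κ/2)}`
    have hn2 : (n : ℝ) ≤ 2 := by exact_mod_cast (by omega : n ≤ 2)
    have h1 : (2 : ℝ) ^ (-(1 + κ / 2)) ≤ (n : ℝ) ^ (-(1 + κ / 2)) :=
      Real.rpow_le_rpow_of_nonpos hn0 hn2 (by linarith)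
    have h2 : (1 / 4 : ℝ) ≤ (2 : ℝ) ^ (-(1 + κ / 2)) := by
      rw [Real.rpow_neg (by norm_num : (0 : ℝ) ≤ 2), ← one_div]
      have h4 : (2 : ℝ) ^ (1 + κ / 2) ≤ 4 :=
        calc (2 : ℝ) ^ (1 + κ / 2) ≤ (2 : ℝ) ^ ((2 : ℕ) : ℝ) :=
              Real.rpow_le_rpow_of_exponent_le (by norm_num) (by push_cast; linarith)
          _ = 4 := by rw [Real.rpow_natCast]; norm_num
      have hpos : 0 < (2 : ℝ) ^ (1 + κ / 2) := Real.rpow_pos_of_pos (by norm_num) _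
      exact one_div_le_one_div_of_le hpos h4
    have h4 : (1 : ℝ) ≤ 4 * (n : ℝ) ^ (-(1 + κ / 2)) := by linarith
    calc criticalTwoPoint 3 x ≤ 1 := hG1
      _ ≤ 4 * (n : ℝ) ^ (-(1 + κ / 2)) := h4
      _ ≤ (Real.sqrt (27 * C) + 4) * (n : ℝ) ^ (-(1 + κ / 2)) := by nlinarith [ht0]

/-- **`η(3) > 0` in power form ⟺ a power gain on the truncated bubble diagram.** The crux `EtaPositive` of
route `AnomalousForcesInteraction` is equivalent to: for some `κ > 0` and `C`,
`B_L(β_c) = Σ_{y ∈ Λ_L} ⟨σ₀σ_y⟩⁺_{β_c(3)}² ≤ C L^{1-κ}` for every `L ≥ 1` — a strict power improvement of the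
infrared growth `B_L ≲ L` of the bubble diagram, the quantity that drives the random-current multiscale
analysis (Aizenman 1982; Aizenman–Duminil-Copin 2021, §6). Shell counting one way (exponent `2 min κ ¼`),
Messager–Miracle-Solé the other (exponent `min κ 1 / 2`). Registered stub of stmt-CriticalPhenomena-2600
(verbatim one-line header). -/
theorem EtaPositive_iff_bubble_gain : Summit.CriticalPhenomena.Ising3DConformalLimit.Theses.AnomalousForcesInteraction.EtaPositive ↔ ∃ κ C : ℝ, 0 < κ ∧ ∀ L : ℕ, 1 ≤ L → ∑ y ∈ Literature.Probability.LatticeModels.box 3 L, Literature.Probability.LatticeModels.criticalTwoPoint 3 y ^ 2 ≤ C * (L : ℝ) ^ (1 - κ) := by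
  unfold Summit.CriticalPhenomena.Ising3DConformalLimit.Theses.AnomalousForcesInteraction.EtaPositive
  constructor
  · rintro ⟨κ, C, hκ, hx⟩
    -- cut the exponent down to `κ' = min κ (1/4)` and the constant up to `C' = max C 0`
    set κ' : ℝ := min κ (1 / 4) with hκ'def
    have hκ'0 : 0 < κ' := lt_min hκ (by norm_num)
    have hκ'1 : κ' ≤ 1 / 4 := min_le_right _ _
    have hκ'κ : κ' ≤ κ := min_le_left _ _
    set C' : ℝ := max C 0 with hC'def
    have hC'0 : 0 ≤ C' := le_max_right _ _
    have hx' : ∀ x : Site 3, x ≠ 0 → criticalTwoPoint 3 x ≤ C' * (‖x‖ : ℝ) ^ (-(1 + κ')) := by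
      intro x hx0
      obtain ⟨hnorm, hn1⟩ := norm_eq_supNorm_and_one_le hx0
      have hp0 : 0 ≤ (‖x‖ : ℝ) ^ (-(1 + κ)) := Real.rpow_nonneg (norm_nonneg _) _
      have hn1' : (1 : ℝ) ≤ ‖x‖ := by rw [hnorm]; exact hn1
      calc criticalTwoPoint 3 x ≤ C * (‖x‖ : ℝ) ^ (-(1 + κ)) := hx x hx0
        _ ≤ C' * (‖x‖ : ℝ) ^ (-(1 + κ)) := mul_le_mul_of_nonneg_right (le_max_left _ _) hp0
        _ ≤ C' * (‖x‖ : ℝ) ^ (-(1 + κ')) :=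
          mul_le_mul_of_nonneg_left (Real.rpow_le_rpow_of_exponent_le hn1' (by linarith)) hC'0
    refine ⟨2 * κ', 1 + 108 * C' ^ 2, by linarith, fun L hL1 => ?_⟩
    have hL1' : (1 : ℝ) ≤ L := by exact_mod_cast hL1
    have hp1 : (1 : ℝ) ≤ (L : ℝ) ^ (1 - 2 * κ') := Real.one_le_rpow hL1' (by linarith)
    have hp0 : (0 : ℝ) ≤ (L : ℝ) ^ (1 - 2 * κ') := by linarith
    have hC2 : 0 ≤ 108 * C' ^ 2 := by positivity
    calc ∑ y ∈ box 3 L, criticalTwoPoint 3 y ^ 2 ≤ 1 + 108 * C' ^ 2 * (L : ℝ) ^ (1 - 2 * κ') :=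
          bubble_le_of_criticalTwoPoint_decay hκ'0 hκ'1 hx' L
      _ ≤ (1 + 108 * C' ^ 2) * (L : ℝ) ^ (1 - 2 * κ') := by nlinarith
  · rintro ⟨κ, C, hκ, hL⟩
    set κ' : ℝ := min κ 1 with hκ'def
    have hκ'0 : 0 < κ' := lt_min hκ one_pos
    have hκ'1 : κ' ≤ 1 := min_le_right _ _
    have hκ'κ : κ' ≤ κ := min_le_left _ _
    set C' : ℝ := max C 0 with hC'def
    have hC'0 : 0 ≤ C' := le_max_right _ _
    have hL' : ∀ L : ℕ, 1 ≤ L → ∑ y ∈ box 3 L, criticalTwoPoint 3 y ^ 2 ≤ C' * (L : ℝ) ^ (1 - κ') := by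
      intro L hL1
      have hL1' : (1 : ℝ) ≤ L := by exact_mod_cast hL1
      have hp0 : 0 ≤ (L : ℝ) ^ (1 - κ) := Real.rpow_nonneg (by linarith) _
      calc ∑ y ∈ box 3 L, criticalTwoPoint 3 y ^ 2 ≤ C * (L : ℝ) ^ (1 - κ) := hL L hL1
        _ ≤ C' * (L : ℝ) ^ (1 - κ) := mul_le_mul_of_nonneg_right (le_max_left _ _) hp0
        _ ≤ C' * (L : ℝ) ^ (1 - κ') :=
          mul_le_mul_of_nonneg_left (Real.rpow_le_rpow_of_exponent_le hL1' (by linarith)) hC'0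
    exact ⟨κ' / 2, Real.sqrt (27 * C') + 4, by positivity,
      criticalTwoPoint_decay_of_bubble_le hκ'0 hκ'1 hC'0 hL'⟩

end Summit.CriticalPhenomena.Ising3DConformalLimit.AnomalousForcesInteractionEtaPositive
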